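import Summits.CriticalPhenomena.PercolationContinuityZ3.Theorems.PercNearOneGluingNoHeavyQuantBinomialToolkit
import Summits.CriticalPhenomena.PercolationContinuityZ3.Theorems.PercNearOneGluingNoHeavyQuantTreeClusterTransfer
import HarnessLib

/-!
# QUANT lane R8 — gate-coordinate law of the closed-leaf count (tool for FAR on the loose-hub tree in the route vocabulary)

builds on p205010 (kernel theorem, internal audit signed; external expert review pending)

Support file (`--supports stmt-CriticalPhenomena-4575`), seat `prim-quant-census-1` (gen 7).  In the gate coordinates of
`Quant.tree_relayCount_transfer` (p219638: `prodBernoulli q` on `Set (Fin n)`), for a finite set `L` of coordinates on which the gate is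
constant `= u`:
* `prodBernoulli_real_closedCyl` — the cylinder 'exactly `T ⊆ L` closed among `L`' has probability `(1−u)^{#T} u^{#L−#T}`
  (independence over the disjoint supports `T`, `L ∖ T`: `prodBernoulli_real_inter_of_determinedBy_disjoint`, `prodBernoulli_real_forall_notMem`,
  `prodBernoulli_real_subset`);
* `prodBernoulli_real_closedCount_le` — **`P(#{x ∈ L : x ∉ ω'} ≤ k) = P(Bin(#L, 1−u) ≤ k)`** (disjoint union of the cylinders over `T ⊆ L`, `#T ≤ k`;
  `Finset.sum_powerset_apply_card`), written with the binomial cdf notation of `…QuantBinomialToolkit` (explicit finite sum, no definition).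
This is the leaf factor needed to evaluate, via two disjoint gate cylinders, the lower bound
`P(count ≥ j+1) ≥ G·[g·P(Bin(m,1−u) ≤ n₀+a) + (1−g)·P(Bin(m,1−u) ≤ n₀)]` for the one-block loose-hub tree (memo
`prim-quant-census-1/FAR-LOOSE-HUB-ONE-BLOCK.md` §1), to be combined with `QuantCensus.DiscountRow.discounted_blockStar_row` (p222943).
No definitions, no sorries; standard axioms.  [folklore]
-/

noncomputable section

open Finset MeasureTheory
open Literature.Probability.LatticeModels Literature.Probability.Percolation
open scoped Classical

namespace Summit.CriticalPhenomena.PercolationContinuityZ3.Theorems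

namespace QuantCensus.DiscountRow

/-- binomial pmf `P(Bin(K,q) = n)` (notation of `…QuantBinomialToolkit`) -/
local notation3 "bpmf[" K ", " n ", " q "]" => (((Nat.choose K n : ℕ) : ℝ) * q ^ n * (1 - q) ^ (K - n))
/-- binomial cdf `P(Bin(K,q) ≤ n)` -/
local notation3 "bcdf[" K ", " n ", " q "]" => (∑ i ∈ Finset.range (n + 1), ((Nat.choose K i : ℕ) : ℝ) * q ^ i * (1 - q) ^ (K - i))

variable {n : ℕ}

/-- The cylinder 'exactly the coordinates of `T ⊆ L` are closed among `L`': `{∀ x ∈ T, x ∉ ω'} ∩ {L ∖ T ⊆ ω'}`. Its probability under a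
gate function constant `= u` on `L` is `(1−u)^{#T} u^{#L − #T}`. [folklore] -/
theorem prodBernoulli_real_closedCyl (q : Fin n → unitInterval) (L T : Finset (Fin n)) (hTL : T ⊆ L) (u : ℝ)
    (hqL : ∀ x ∈ L, ((q x : unitInterval) : ℝ) = u) :
    (prodBernoulli q).real ({ω' : Set (Fin n) | ∀ x ∈ T, x ∉ ω'} ∩ {ω' | ((L \ T : Finset (Fin n)) : Set (Fin n)) ⊆ ω'}) =
      (1 - u) ^ T.card * u ^ (L.card - T.card) := by
  have hdet1 : DeterminedBy {ω' : Set (Fin n) | ∀ x ∈ T, x ∉ ω'} (↑T : Set (Fin n)) := by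
    rw [determinedBy_iff]
    intro ω ω' hωω'
    simp only [Set.mem_setOf_eq]
    refine forall_congr' fun x => imp_congr_right fun hx => ?_
    have := Set.ext_iff.1 hωω' x
    simp only [Set.mem_inter_iff, Finset.mem_coe, hx, and_true] at this
    exact not_congr this
  have hdet2 : DeterminedBy {ω' : Set (Fin n) | ((L \ T : Finset (Fin n)) : Set (Fin n)) ⊆ ω'} (↑(L \ T) : Set (Fin n)) := by
    rw [determinedBy_iff]
    intro ω ω' hωω'
    simp only [Set.mem_setOf_eq, Set.subset_def, Finset.mem_coe]
    refine forall_congr' fun x => imp_congr_right fun hx => ?_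
    have := Set.ext_iff.1 hωω' x
    simp only [Set.mem_inter_iff, Finset.mem_coe, hx, and_true] at this
    exact this
  rw [prodBernoulli_real_inter_of_determinedBy_disjoint q Finset.disjoint_sdiff hdet1 hdet2
    MeasurableSet.of_discrete MeasurableSet.of_discrete,
    prodBernoulli_real_forall_notMem, prodBernoulli_real_subset]
  rw [Finset.prod_congr rfl (fun x hx => by rw [hqL x (hTL hx)]), Finset.prod_const,
    Finset.prod_congr rfl (fun x hx => by rw [hqL x (Finset.sdiff_subset hx)]), Finset.prod_const,
    Finset.card_sdiff_of_subset hTL]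

/-- **Law of the closed count of `L`.**  If the gate is constant `= u` on `L`, then
`P(#{x ∈ L : x ∉ ω'} ≤ k) = P(Bin(#L, 1−u) ≤ k)`. [folklore] -/
theorem prodBernoulli_real_closedCount_le (q : Fin n → unitInterval) (L : Finset (Fin n)) (u : ℝ)
    (hqL : ∀ x ∈ L, ((q x : unitInterval) : ℝ) = u) (k : ℕ) :
    (prodBernoulli q).real {ω' : Set (Fin n) | (L.filter (fun x => x ∉ ω')).card ≤ k} = bcdf[L.card, k, 1 - u] := by
  set μ := prodBernoulli q with hμ
  set cyl : Finset (Fin n) → Set (Set (Fin n)) :=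
    fun T => {ω' : Set (Fin n) | ∀ x ∈ T, x ∉ ω'} ∩ {ω' | ((L \ T : Finset (Fin n)) : Set (Fin n)) ⊆ ω'} with hcyl
  -- the event is the disjoint union of the cylinders over closed sets T of size ≤ k
  have hmem : ∀ (ω' : Set (Fin n)) (T : Finset (Fin n)), T ⊆ L → (ω' ∈ cyl T ↔ L.filter (fun x => x ∉ ω') = T) := by
    intro ω' T hTL
    simp only [hcyl, Set.mem_inter_iff, Set.mem_setOf_eq, Set.subset_def, Finset.mem_coe, Finset.mem_sdiff]
    constructor
    · rintro ⟨h1, h2⟩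
      ext x
      simp only [Finset.mem_filter]
      constructor
      · rintro ⟨hxL, hxω⟩
        by_contra hxT
        exact hxω (h2 x ⟨hxL, hxT⟩)
      · intro hxT
        exact ⟨hTL hxT, h1 x hxT⟩
    · intro h
      constructor
      · intro x hxT
        rw [← h] at hxT
        exact (Finset.mem_filter.1 hxT).2
      · rintro x ⟨hxL, hxT⟩
        by_contra hxω
        exact hxT (h ▸ Finset.mem_filter.2 ⟨hxL, hxω⟩)
  have hU : {ω' : Set (Fin n) | (L.filter (fun x => x ∉ ω')).card ≤ k} =
      ⋃ T ∈ L.powerset.filter (fun T => T.card ≤ k), cyl T := by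
    ext ω'
    simp only [Set.mem_setOf_eq, Set.mem_iUnion, Finset.mem_filter, Finset.mem_powerset, exists_prop]
    constructor
    · intro h
      refine ⟨L.filter (fun x => x ∉ ω'), ⟨Finset.filter_subset _ _, h⟩, ?_⟩
      exact (hmem ω' _ (Finset.filter_subset _ _)).2 rfl
    · rintro ⟨T, ⟨hTL, hTk⟩, hω⟩
      rw [(hmem ω' T hTL).1 hω]
      exact hTk
  have hdisj : Set.PairwiseDisjoint (↑(L.powerset.filter (fun T => T.card ≤ k)) : Set (Finset (Fin n))) cyl := by
    intro T hT T' hT' hne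
    rw [Function.onFun, Set.disjoint_left]
    intro ω' h1 h2
    simp only [Finset.coe_filter, Finset.mem_powerset, Set.mem_setOf_eq] at hT hT'
    have e1 := (hmem ω' T hT.1).1 h1
    have e2 := (hmem ω' T' hT'.1).1 h2
    exact hne (e1.symm.trans e2)
  rw [hU, measureReal_biUnion_finset hdisj (fun T _ => MeasurableSet.of_discrete)]
  -- each cylinder has probability (1-u)^{#T} u^{#L - #T}
  have hval : ∀ T ∈ L.powerset.filter (fun T => T.card ≤ k), μ.real (cyl T) = (1 - u) ^ T.card * u ^ (L.card - T.card) := by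
    intro T hT
    simp only [Finset.mem_filter, Finset.mem_powerset] at hT
    exact prodBernoulli_real_closedCyl q L T hT.1 u hqL
  rw [Finset.sum_congr rfl hval, Finset.sum_filter]
  -- sum over the powerset by cardinality
  have hcard := Finset.sum_powerset_apply_card (fun i => if i ≤ k then (1 - u) ^ i * u ^ (L.card - i) else 0) (x := L)
  rw [hcard]
  simp only [nsmul_eq_mul]
  -- ∑_{i < #L+1} C(#L,i) [i ≤ k] (1-u)^i u^{#L-i} = bcdf[#L, k, 1-u]
  have hpush : ∑ x ∈ Finset.range (L.card + 1), ((L.card.choose x : ℕ) : ℝ) * (if x ≤ k then (1 - u) ^ x * u ^ (L.card - x) else 0) =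
      ∑ x ∈ (Finset.range (L.card + 1)).filter (fun i => i ≤ k), ((L.card.choose x : ℕ) : ℝ) * ((1 - u) ^ x * u ^ (L.card - x)) := by
    rw [Finset.sum_filter]
    refine Finset.sum_congr rfl fun x _ => ?_
    split_ifs <;> simp
  rw [hpush]
  have hterm : ∀ i : ℕ, ((L.card.choose i : ℕ) : ℝ) * ((1 - u) ^ i * u ^ (L.card - i)) =
      ((Nat.choose L.card i : ℕ) : ℝ) * (1 - u) ^ i * (1 - (1 - u)) ^ (L.card - i) := by
    intro i; rw [sub_sub_cancel]; ring
  rcases Nat.lt_or_ge k L.card with hk | hk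
  · have hflt : (Finset.range (L.card + 1)).filter (fun i => i ≤ k) = Finset.range (k + 1) := by
      ext i; simp only [Finset.mem_filter, Finset.mem_range]; omega
    rw [hflt]
    exact Finset.sum_congr rfl fun i _ => hterm i
  · have hflt : (Finset.range (L.card + 1)).filter (fun i => i ≤ k) = Finset.range (L.card + 1) := by
      ext i; simp only [Finset.mem_filter, Finset.mem_range]; omega
    rw [hflt, bcdf_of_le L.card k (1 - u) hk]
    have h2 : ∑ x ∈ Finset.range (L.card + 1), ((L.card.choose x : ℕ) : ℝ) * ((1 - u) ^ x * u ^ (L.card - x)) =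
        bcdf[L.card, L.card, 1 - u] := Finset.sum_congr rfl fun i _ => hterm i
    rw [h2]
    exact bcdf_self _ _

end QuantCensus.DiscountRow

end Summit.CriticalPhenomena.PercolationContinuityZ3.Theorems

end
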